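import Summits.QuantumFields.YangMills.Theorems.UnitScaleTiltProp7LatticeBoxPoincareL2
import HarnessLib

/-!
# Route `UnitScaleTilt`, crux K1 «MinimiserStabilityRegPr» (stmt-QuantumFields-19200), route-R E′ path (α′) — the sup-row residue (hK), brick (D1-cell), part 2 of 2:
# THE VERTEX-PINNED `H²` MORREY–POINCARÉ INEQUALITY ON A LATTICE CELL OF ℤ³, WITH A SIDE-UNIFORM CONSTANT

Cell `ym3-torus`, D-0154 (3c) twin-width seat `ym-routeR-w2` (gen 5).  THEOREMS ONLY (0 `def`, 0 `sorry`); `--supports stmt-QuantumFields-19200 --as helper`,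
count-neutral.  YM₃ on T³ is a ladder rung (R3), not the Clay problem; nothing here claims the stub, the crux, d = 4 or the gap.

THE POINT (★routeR-w3 g5 17:53:25Z dissection of (hK), item (D1); ★p1 g14 17:53:40Z «the key remark»; LOCATE `ym-routeR-w2/LOCATE-HK-D1-ROWS-routeRw2g5.md`).
The `W^{1,∞}` interpolation bound `hInterp` of ✓ `…CentreHarmonicRegaugeSup` reduces (✓ `…CentreHarmonicInterpKernel.norm_grad_interp_error_le`) to pointwise decay of the
pinned biharmonic Green's matrix `G₂ = (Δ²|_{e|_C = 0})⁻¹`, and every step of that decay (the global gap `‖e‖ ≲ ℓ²‖Δe‖`, the form-relative Combes–Thomas bound, the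
conversion of cell energies into point values) rests on ONE local inequality: a lattice function vanishing at the 8 vertices of a cell of side `s` has
`Σ_cell u² ≤ C·s⁴·(Hessian energy near the cell)` with `C` independent of `s` — the discrete `H² ↪ C^{0,1∕2}` Morrey embedding in `d = 3` modulo affine functions, the
affine part being killed by the 8 vertex values (one pin per cell is NOT enough: the Hessian seminorm vanishes on affine functions).

WHAT IS PROVED (ns `…Theorems.Prop7VertexPinnedMorreyCell`; letters of lit `B4Eq19LatticeOperators`∕`BoxMeans`∕`PoincareMorrey`: `Zd d` with `d = 3`, `box` (`Q_r(z)` = sup-ball),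
`fdiff`, `gradSq`, `exc`, `boxAvg`; the Hessian energy is written inline as `Σ_μ gradSq (fdiff μ u) Q`; part 1 = ✓ `…Prop7LatticeBoxPoincareL2`).
* §3 `exists_dyadic_exponent`, `fdiff_sub_affine`, `exc_le_of_hessian` (`exc (∂_νu) a r ≤ 12H(r+1)²` inside the master box), ★ `sum_sq_fdiff_sub_mean_le`,
  ★★ `gradSq_affineCorr_le` — MORREY GROWTH of `w = u − Σ_μ m_μ x_μ`, `m_μ = avg_{Q_{5s+1}(z₀)} ∂_μu`: `gradSq w (Q_ρ(a)) ≤ 46116·H·(ρ+1)²` for `|a − z₀|_∞ ≤ s`, `ρ ≤ 2s`.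
* §4 ★★ `abs_sub_affineCorr_le` — ✓ `abs_sub_le_of_morrey` (`d − 1 = 2`) ⟹ `|w x − w a| ≤ 17√(16·3·8³)·√(46116·H·(2s+1))` for `x ∈ Q_s(a)`, both within `s` of `z₀`.
* §5 `sum_trilinear_eq_one`, `sum_trilinear_mul_eq`, ★ `abs_le_of_vanish_vertices` — trilinear weights reproduce affine functions; with the 8 vertex zeros `|u x| ≤ B`.
* §6 ★★★ `sum_sq_le_hessian_of_vanish_vertices` — `Σ_{x ∈ cell} u(x)² ≤ C_M·s⁴·Σ_μ gradSq (∂_μu) (Q_{5s+1}(v))`, `C_M = 24·289·24576·46116` (absolute).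
HONEST SCOPE.  Pure real-variable lattice analysis on `ℤ³` (scalar `u`; vector∕matrix fields componentwise by the caller); the torus∕`SiteField` dictionary, the global
coercivity, Combes–Thomas and the Green's-function bounds of (hK) are NOT here.  Constants ours and far from sharp.

References: M. Giaquinta, *Multiple integrals in the calculus of variations and nonlinear elliptic systems*, Princeton 1983 [Giaquinta1984] (Ch. III §1 pp.64–72);
T. Bałaban, CMP 96 (1984) 223–250 [Balaban1984PropagatorsII] ((1.9) p.226); CMP 102 (1985) 277–309 [Balaban1985Variational] (Prop. 7 p.299).
-/

set_option autoImplicit false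

noncomputable section

open scoped BigOperators

namespace Summit.QuantumFields.YangMills.Theorems.Prop7VertexPinnedMorreyCell

open Literature.MathematicalPhysics.QuantumFieldTheory.Balaban1983to89
open B4Eq19LatticeOperators B4Eq19LatticeBoxMeans B4Eq19LatticePoincareMorrey
open Summit.QuantumFields.YangMills.Theorems.Prop7LatticeBoxPoincareL2
open Finset

variable {d : ℕ}

/-! ## §3 Morrey growth of the affine-corrected function (d = 3) -/

/-- a dyadic exponent adapted to the scale `s`: for `0 ≤ ρ ≤ 2s` there is `K` with `2s+1 ≤ 2^K(ρ+1) ≤ 4s+2`. [folklore] -/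
theorem exists_dyadic_exponent {ρ : ℤ} (hρ : 0 ≤ ρ) (s : ℕ) (hρs : ρ ≤ 2 * (s : ℤ)) :
    ∃ K : ℕ, 2 * (s : ℤ) + 1 ≤ (2 : ℤ) ^ K * (ρ + 1) ∧ (2 : ℤ) ^ K * (ρ + 1) ≤ 4 * (s : ℤ) + 2 := by
  classical
  let P : ℕ → Prop := fun K => 2 * (s : ℤ) + 1 ≤ (2 : ℤ) ^ K * (ρ + 1)
  have hex : ∃ K, P K := by
    refine ⟨2 * s + 1, ?_⟩
    show 2 * (s : ℤ) + 1 ≤ (2 : ℤ) ^ (2 * s + 1) * (ρ + 1)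
    have h1 : ((2 * s + 1 : ℕ) : ℤ) < (2 : ℤ) ^ (2 * s + 1) := by exact_mod_cast Nat.lt_two_pow_self
    push_cast at h1
    nlinarith [pow_pos (show (0:ℤ) < 2 by norm_num) (2 * s + 1)]
  refine ⟨Nat.find hex, Nat.find_spec hex, ?_⟩
  rcases Nat.eq_zero_or_pos (Nat.find hex) with h0 | hpos
  · rw [h0]; simp; linarith
  · obtain ⟨k, hk⟩ : ∃ k, Nat.find hex = k + 1 := ⟨Nat.find hex - 1, by omega⟩
    have hnot : ¬ P k := Nat.find_min hex (by omega)
    rw [hk, pow_succ]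
    show (2 : ℤ) ^ k * 2 * (ρ + 1) ≤ 4 * (s : ℤ) + 2
    have : ¬ (2 * (s : ℤ) + 1 ≤ (2 : ℤ) ^ k * (ρ + 1)) := hnot
    push Not at this
    linarith

/-- the forward differences of the affine-corrected function: `∂_ν (u − m·x) = ∂_ν u − m_ν`. [folklore] -/
theorem fdiff_sub_affine (u : Zd d → ℝ) (m : Fin d → ℝ) (ν : Fin d) (x : Zd d) :
    fdiff ν (fun y => u y - ∑ μ, m μ * ((y μ : ℤ) : ℝ)) x = fdiff ν u x - m ν := by
  simp only [fdiff]
  have h : ∀ μ, m μ * (((x + unitVec ν) μ : ℤ) : ℝ) - m μ * ((x μ : ℤ) : ℝ) = if μ = ν then m μ else 0 := by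
    intro μ
    by_cases hμ : μ = ν
    · subst hμ; simp; ring
    · simp [hμ]
  have hsum : ∑ μ, m μ * (((x + unitVec ν) μ : ℤ) : ℝ) - ∑ μ, m μ * ((x μ : ℤ) : ℝ) = m ν := by
    rw [← Finset.sum_sub_distrib, Finset.sum_congr rfl fun μ _ => h μ, Finset.sum_ite_eq']; simp
  linarith [hsum]

/-- the `exc`-growth of a component `f = ∂_νu` on boxes inside the master box: `exc f a r ≤ 12H(r+1)²` (§1 + monotonicity). [folklore] -/
theorem exc_le_of_hessian (hd : d = 3) (f : Zd d → ℝ) (z₀ a : Zd d) {R r : ℤ} (hr : 0 ≤ r) {H : ℝ} (hH : gradSq f (box z₀ R) ≤ H)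
    (hsub : box a r ⊆ box z₀ R) : exc f a r ≤ 12 * H * ((r : ℝ) + 1) ^ 2 := by
  subst hd
  have h1 := exc_le_gradSq f a hr
  have hg0 : 0 ≤ gradSq f (box a r) := gradSq_nonneg _ _
  have hmono : gradSq f (box a r) ≤ H := (gradSq_mono f hsub).trans hH
  have hH0 : 0 ≤ H := hg0.trans hmono
  have e : ((3 : ℕ) : ℝ) * (((2 * r + 1 : ℤ) : ℝ)) ^ 2 = 3 * (2 * (r : ℝ) + 1) ^ 2 := by push_cast; ring
  rw [e] at h1
  have hr' : (0 : ℝ) ≤ r := by exact_mod_cast hr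
  calc exc f a r ≤ 3 * (2 * (r : ℝ) + 1) ^ 2 * gradSq f (box a r) := h1
    _ ≤ 3 * (2 * (r : ℝ) + 1) ^ 2 * H := mul_le_mul_of_nonneg_left hmono (by positivity)
    _ ≤ 12 * H * ((r : ℝ) + 1) ^ 2 := by nlinarith [mul_nonneg hH0 (sq_nonneg (r:ℝ)), hH0]

/-- ★ **ONE COMPONENT**: with `m_ν = avg_{Q_R(z₀)} ∂_νu`, `R = 5s+1`, `|a − z₀|_∞ ≤ s`, `0 ≤ ρ ≤ 2s`:
`Σ_{x∈Q_ρ(a)} (∂_νu(x) − m_ν)² ≤ 15372·H·(ρ+1)²`. [folklore] [cite: Giaquinta1984, Ch. III §1 Thm 1.2 pp.70–72] -/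
theorem sum_sq_fdiff_sub_mean_le (hd : d = 3) (u : Zd d → ℝ) (z₀ a : Zd d) {s : ℕ} (hs : 1 ≤ s) {H : ℝ} (ν : Fin d)
    (hH : gradSq (fdiff ν u) (box z₀ (5 * (s : ℤ) + 1)) ≤ H) (ha : ∀ i, |a i - z₀ i| ≤ (s : ℤ)) {ρ : ℤ} (hρ : 0 ≤ ρ) (hρs : ρ ≤ 2 * (s : ℤ)) :
    ∑ x ∈ box a ρ, (fdiff ν u x - boxAvg (fdiff ν u) z₀ (5 * (s : ℤ) + 1)) ^ 2 ≤ 15372 * H * ((ρ : ℝ) + 1) ^ 2 := by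
  set f := fdiff ν u with hf
  set R : ℤ := 5 * (s : ℤ) + 1 with hR
  have hH0 : 0 ≤ H := (gradSq_nonneg _ _).trans hH
  have hρR : (0 : ℝ) ≤ ρ := by exact_mod_cast hρ
  -- boxes around `a` of radius `≤ 4s+1` lie in the master box
  have hsub : ∀ r : ℤ, r ≤ 4 * (s : ℤ) + 1 → box a r ⊆ box z₀ R := fun r hr =>
    box_subset_box fun i => by have := ha i; rw [hR]; linarith
  have hexcA : ∀ r : ℤ, 0 ≤ r → r ≤ 4 * (s : ℤ) + 1 → exc f a r ≤ 12 * H * ((r : ℝ) + 1) ^ 2 := fun r hr0 hr =>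
    exc_le_of_hessian hd f z₀ a hr0 hH (hsub r hr)
  obtain ⟨K, hK1, hK2⟩ := exists_dyadic_exponent hρ s hρs
  set rK : ℤ := (2 : ℤ) ^ K * (ρ + 1) - 1 with hrK
  -- dyadic part
  have hdy : (boxAvg f a ρ - boxAvg f a rK) ^ 2 ≤ 64 * (12 * H) / ((ρ : ℝ) + 1) := by
    refine sq_boxAvg_sub_dyadic_le hd f a hρ (by positivity) K fun k hk => ?_
    have h2k : (2 : ℤ) ^ k * (ρ + 1) ≤ (2 : ℤ) ^ K * (ρ + 1) :=
      mul_le_mul_of_nonneg_right (pow_le_pow_right₀ (by norm_num) hk) (by linarith)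
    have h1k : (1 : ℤ) ≤ (2 : ℤ) ^ k := one_le_pow₀ (by norm_num)
    have hr0 : (0 : ℤ) ≤ (2 : ℤ) ^ k * (ρ + 1) - 1 := by nlinarith
    have h := hexcA ((2 : ℤ) ^ k * (ρ + 1) - 1) hr0 (by linarith)
    have e : ((((2 : ℤ) ^ k * (ρ + 1) - 1 : ℤ) : ℝ) + 1) = (2 : ℝ) ^ k * ((ρ : ℝ) + 1) := by push_cast; ring
    rw [e] at h
    exact h
  -- master part
  have hρrK : ρ ≤ rK := by
    have h1K : (1 : ℤ) ≤ (2 : ℤ) ^ K := one_le_pow₀ (by norm_num)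
    rw [hrK]; nlinarith
  have hma : ((box a ρ).card : ℝ) * (boxAvg f a rK - boxAvg f z₀ R) ^ 2 ≤ 128 * (12 * H) * ((ρ : ℝ) + 1) ^ 2 := by
    refine card_mul_sq_boxAvg_sub_master_le hd f a z₀ hρ hρrK (by positivity) (hsub rK (by rw [hrK]; linarith)) ?_ ?_
    · have e1 : ((rK : ℝ) + 1) = (((2 : ℤ) ^ K * (ρ + 1) : ℤ) : ℝ) := by rw [hrK]; push_cast; ring
      have hK1R : (2 * (s : ℝ) + 1) ≤ (((2 : ℤ) ^ K * (ρ + 1) : ℤ) : ℝ) := by exact_mod_cast hK1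
      have eR : ((R : ℝ) + 1) = 5 * (s : ℝ) + 2 := by rw [hR]; push_cast; ring
      rw [e1, eR]
      have hs0 : (0 : ℝ) ≤ s := Nat.cast_nonneg s
      nlinarith
    · have hR0 : (0 : ℤ) ≤ R := by rw [hR]; positivity
      have h := exc_le_of_hessian hd f z₀ z₀ hR0 hH (subset_refl _)
      exact h
  -- combine
  obtain ⟨_, _, hcardhi⟩ := card_box_three hd a hρ
  have hsplit : ((box a ρ).card : ℝ) * (boxAvg f a ρ - boxAvg f z₀ R) ^ 2 ≤ 15360 * H * ((ρ : ℝ) + 1) ^ 2 := by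
    have h2 : (boxAvg f a ρ - boxAvg f z₀ R) ^ 2 ≤ 2 * (boxAvg f a ρ - boxAvg f a rK) ^ 2 + 2 * (boxAvg f a rK - boxAvg f z₀ R) ^ 2 := by
      nlinarith [sq_nonneg ((boxAvg f a ρ - boxAvg f a rK) - (boxAvg f a rK - boxAvg f z₀ R))]
    have hc0 : (0 : ℝ) ≤ ((box a ρ).card : ℝ) := Nat.cast_nonneg _
    have hρ1 : (0 : ℝ) < (ρ : ℝ) + 1 := by linarith
    have hdy' : ((box a ρ).card : ℝ) * (boxAvg f a ρ - boxAvg f a rK) ^ 2 ≤ 8 * ((ρ : ℝ) + 1) ^ 3 * (64 * (12 * H) / ((ρ : ℝ) + 1)) :=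
      (mul_le_mul_of_nonneg_right hcardhi (sq_nonneg _)).trans (mul_le_mul_of_nonneg_left hdy (by positivity))
    have e8 : 8 * ((ρ : ℝ) + 1) ^ 3 * (64 * (12 * H) / ((ρ : ℝ) + 1)) = 6144 * H * ((ρ : ℝ) + 1) ^ 2 := by
      field_simp; ring
    rw [e8] at hdy'
    calc ((box a ρ).card : ℝ) * (boxAvg f a ρ - boxAvg f z₀ R) ^ 2
        ≤ ((box a ρ).card : ℝ) * (2 * (boxAvg f a ρ - boxAvg f a rK) ^ 2 + 2 * (boxAvg f a rK - boxAvg f z₀ R) ^ 2) :=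
          mul_le_mul_of_nonneg_left h2 hc0
      _ = 2 * (((box a ρ).card : ℝ) * (boxAvg f a ρ - boxAvg f a rK) ^ 2) + 2 * (((box a ρ).card : ℝ) * (boxAvg f a rK - boxAvg f z₀ R) ^ 2) := by ring
      _ ≤ 2 * (6144 * H * ((ρ : ℝ) + 1) ^ 2) + 2 * (128 * (12 * H) * ((ρ : ℝ) + 1) ^ 2) := by linarith [hdy', hma]
      _ = 15360 * H * ((ρ : ℝ) + 1) ^ 2 := by ring
  have hexcρ : exc f a ρ ≤ 12 * H * ((ρ : ℝ) + 1) ^ 2 := hexcA ρ hρ (by linarith)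
  rw [sum_sq_sub_eq f a ρ]
  linarith [hsplit, hexcρ]

/-- ★★ **MORREY GROWTH OF THE AFFINE-CORRECTED FUNCTION**: with `m_μ = avg_{Q_{5s+1}(z₀)} ∂_μu` and `w = u − Σ_μ m_μ x_μ`, for `|a − z₀|_∞ ≤ s` and `0 ≤ ρ ≤ 2s`:
`gradSq w (Q_ρ(a)) ≤ 46116·H·(ρ+1)²`, `H ≥ max_μ gradSq (∂_μu) (Q_{5s+1}(z₀))` — the hypothesis of ✓ `abs_sub_le_of_morrey` with `d − 1 = 2`.
[folklore] [cite: Giaquinta1984, Ch. III §1 Thm 1.2 pp.70–72] -/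
theorem gradSq_affineCorr_le (hd : d = 3) (u : Zd d → ℝ) (z₀ a : Zd d) {s : ℕ} (hs : 1 ≤ s) {H : ℝ}
    (hH : ∀ μ, gradSq (fdiff μ u) (box z₀ (5 * (s : ℤ) + 1)) ≤ H) (ha : ∀ i, |a i - z₀ i| ≤ (s : ℤ)) {ρ : ℤ} (hρ : 0 ≤ ρ) (hρs : ρ ≤ 2 * (s : ℤ)) :
    gradSq (fun y => u y - ∑ μ, boxAvg (fdiff μ u) z₀ (5 * (s : ℤ) + 1) * ((y μ : ℤ) : ℝ)) (box a ρ) ≤ 46116 * H * ((ρ : ℝ) + 1) ^ 2 := by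
  subst hd
  rw [gradSq_def]
  have hcomp : ∀ ν, ∑ x ∈ box a ρ, (fdiff ν (fun y => u y - ∑ μ, boxAvg (fdiff μ u) z₀ (5 * (s : ℤ) + 1) * ((y μ : ℤ) : ℝ)) x) ^ 2
      ≤ 15372 * H * ((ρ : ℝ) + 1) ^ 2 := by
    intro ν
    have e : ∀ x, fdiff ν (fun y => u y - ∑ μ, boxAvg (fdiff μ u) z₀ (5 * (s : ℤ) + 1) * ((y μ : ℤ) : ℝ)) x
        = fdiff ν u x - boxAvg (fdiff ν u) z₀ (5 * (s : ℤ) + 1) := fun x => fdiff_sub_affine u _ ν x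
    simp only [e]
    exact sum_sq_fdiff_sub_mean_le rfl u z₀ a hs ν (hH ν) ha hρ hρs
  rw [Finset.sum_comm]
  calc ∑ ν, ∑ x ∈ box a ρ, (fdiff ν (fun y => u y - ∑ μ, boxAvg (fdiff μ u) z₀ (5 * (s : ℤ) + 1) * ((y μ : ℤ) : ℝ)) x) ^ 2
      ≤ ∑ ν : Fin 3, 15372 * H * ((ρ : ℝ) + 1) ^ 2 := Finset.sum_le_sum fun ν _ => hcomp ν
    _ = 46116 * H * ((ρ : ℝ) + 1) ^ 2 := by rw [Finset.sum_const, Finset.card_univ, Fintype.card_fin]; ring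

/-! ## §4 The oscillation of the affine-corrected function over the cell scale -/

/-- ★★ `|w(x) − w(a)| ≤ 17√(16·3·8³)·√(46116·H·(2s+1))` for `x ∈ Q_s(a)`, both within `s` of `z₀` (✓ `abs_sub_le_of_morrey`, `d − 1 = 2`, `ρ₀ = s`, `R₀ = 2s`).
[folklore] [cite: Giaquinta1984, Ch. III §1 Thm 1.2 pp.70–72] -/
theorem abs_sub_affineCorr_le (hd : d = 3) (u : Zd d → ℝ) (z₀ : Zd d) {s : ℕ} (hs : 1 ≤ s) {H : ℝ}
    (hH : ∀ μ, gradSq (fdiff μ u) (box z₀ (5 * (s : ℤ) + 1)) ≤ H) {a x : Zd d} (ha : ∀ i, |a i - z₀ i| ≤ (s : ℤ))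
    (hx : ∀ i, |x i - z₀ i| ≤ (s : ℤ)) (hxa : x ∈ box a (s : ℤ)) :
    |(u x - ∑ μ, boxAvg (fdiff μ u) z₀ (5 * (s : ℤ) + 1) * ((x μ : ℤ) : ℝ)) -
        (u a - ∑ μ, boxAvg (fdiff μ u) z₀ (5 * (s : ℤ) + 1) * ((a μ : ℤ) : ℝ))|
      ≤ 17 * Real.sqrt (16 * (3 : ℕ) * 8 ^ 3) * Real.sqrt (46116 * H * (2 * (s : ℝ) + 1)) := by
  subst hd
  have hH0 : 0 ≤ H := (gradSq_nonneg _ _).trans (hH 0)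
  set w : Zd 3 → ℝ := fun y => u y - ∑ μ, boxAvg (fdiff μ u) z₀ (5 * (s : ℤ) + 1) * ((y μ : ℤ) : ℝ) with hw
  have h := abs_sub_le_of_morrey (d := 3) (by norm_num) w (a := a) (x' := x) (ρ₀ := s) hs hxa (N := 46116 * H) (by positivity)
    (R₀ := 2 * (s : ℤ)) (le_refl _)
    (fun ρ hρ hρs => by have := gradSq_affineCorr_le rfl u z₀ a hs hH ha hρ hρs; simpa using this)
    (fun ρ hρ hρs => by have := gradSq_affineCorr_le rfl u z₀ x hs hH hx hρ hρs; simpa using this)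
  simpa [hw] using h


/-! ## §5 Trilinear weights: the 8 vertex values control an affine function on the cell -/

/-- the trilinear weights sum to one: `Σ_ε Π_i θ_i(ε_i) = Π_i (θ_i(0) + θ_i(1)) = 1` for `θ_i(1) = t_i`, `θ_i(0) = 1 − t_i`. [folklore] -/
theorem sum_trilinear_eq_one (t : Fin d → ℝ) :
    ∑ ε : Fin d → Fin 2, ∏ i, (if ε i = 1 then t i else 1 - t i) = 1 := by
  classical
  have h := Finset.prod_univ_sum (fun _ : Fin d => (Finset.univ : Finset (Fin 2))) (fun i (b : Fin 2) => if b = 1 then t i else 1 - t i)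
  rw [Fintype.piFinset_univ] at h
  rw [← h]
  simp [Fin.sum_univ_two]

/-- the trilinear weights reproduce the first moments: `Σ_ε (Π_i θ_i(ε_i))·ε_μ = t_μ`. [folklore] -/
theorem sum_trilinear_mul_eq (t : Fin d → ℝ) (μ : Fin d) :
    ∑ ε : Fin d → Fin 2, (∏ i, (if ε i = 1 then t i else 1 - t i)) * (((ε μ : ℕ) : ℝ)) = t μ := by
  classical
  -- fold the extra factor into the `μ`-th slot
  have hfac : ∀ ε : Fin d → Fin 2, (∏ i, (if ε i = 1 then t i else 1 - t i)) * (((ε μ : ℕ) : ℝ)) =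
      ∏ i, ((if ε i = 1 then t i else 1 - t i) * (if i = μ then (((ε i : ℕ) : ℝ)) else 1)) := by
    intro ε
    rw [Finset.prod_mul_distrib]
    congr 1
    rw [Finset.prod_ite_eq']; simp
  simp only [hfac]
  have h := Finset.prod_univ_sum (fun _ : Fin d => (Finset.univ : Finset (Fin 2)))
    (fun i (b : Fin 2) => (if b = 1 then t i else 1 - t i) * (if i = μ then (((b : ℕ) : ℝ)) else 1))
  rw [Fintype.piFinset_univ] at h
  rw [← h]
  -- each factor: `i = μ` gives `t_μ`, `i ≠ μ` gives `1`
  have hf : ∀ i, (∑ b : Fin 2, (if b = 1 then t i else 1 - t i) * (if i = μ then (((b : ℕ) : ℝ)) else 1)) = if i = μ then t i else 1 := by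
    intro i
    by_cases hi : i = μ
    · subst hi; simp [Fin.sum_univ_two]
    · simp [Fin.sum_univ_two, hi]
  simp only [hf]
  rw [Finset.prod_ite_eq']; simp

/-- ★ **VERTEX CONTROL**: on the cell `Π_i [v_i, v_i + s]` write `u = w + A`, `A(x) = Σ_μ m_μ x_μ`; if `u` vanishes at the 8 vertices `v + s·ε` and
`|w(x) − w(v + s·ε)| ≤ B` for every vertex, then `|u(x)| ≤ B` (`A(x) = Σ_ε θ_ε(x)A(v+sε) = −Σ_ε θ_ε(x)w(v+sε)`, `θ_ε ≥ 0`, `Σθ_ε = 1`). [folklore] -/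
theorem abs_le_of_vanish_vertices (u : Zd d → ℝ) (m : Fin d → ℝ) (v : Zd d) {s : ℕ} (hs : 1 ≤ s) {x : Zd d}
    (hx : x ∈ Fintype.piFinset fun i => Finset.Icc (v i) (v i + s)) {B : ℝ}
    (h0 : ∀ ε : Fin d → Fin 2, u (fun i => v i + (s : ℤ) * ((ε i : ℕ) : ℤ)) = 0)
    (hB : ∀ ε : Fin d → Fin 2, |(u x - ∑ μ, m μ * ((x μ : ℤ) : ℝ)) -
        (u (fun i => v i + (s : ℤ) * ((ε i : ℕ) : ℤ)) - ∑ μ, m μ * ((((fun i => v i + (s : ℤ) * ((ε i : ℕ) : ℤ)) : Zd d) μ : ℤ) : ℝ))| ≤ B) :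
    |u x| ≤ B := by
  classical
  have hs0 : (0 : ℝ) < s := by exact_mod_cast hs
  set t : Fin d → ℝ := fun i => (((x i - v i : ℤ) : ℝ)) / s with ht
  set θ : (Fin d → Fin 2) → ℝ := fun ε => ∏ i, (if ε i = 1 then t i else 1 - t i) with hθ
  set w : Zd d → ℝ := fun y => u y - ∑ μ, m μ * ((y μ : ℤ) : ℝ) with hw
  set p : (Fin d → Fin 2) → Zd d := fun ε i => v i + (s : ℤ) * ((ε i : ℕ) : ℤ) with hp
  have hx' : ∀ i, v i ≤ x i ∧ x i ≤ v i + s := fun i => by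
    have := Fintype.mem_piFinset.mp hx i; rwa [Finset.mem_Icc] at this
  -- weights: nonnegative, sum one, reproduce coordinates
  have ht01 : ∀ i, 0 ≤ t i ∧ t i ≤ 1 := by
    intro i
    obtain ⟨h1, h2⟩ := hx' i
    have h1' : (0 : ℝ) ≤ ((x i - v i : ℤ) : ℝ) := by exact_mod_cast (by linarith : (0:ℤ) ≤ x i - v i)
    have h2' : ((x i - v i : ℤ) : ℝ) ≤ s := by exact_mod_cast (by linarith : x i - v i ≤ (s : ℤ))
    exact ⟨div_nonneg h1' hs0.le, by rw [ht]; exact (div_le_one hs0).mpr h2'⟩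
  have hθ0 : ∀ ε, 0 ≤ θ ε := fun ε => Finset.prod_nonneg fun i _ => by
    split_ifs
    · exact (ht01 i).1
    · linarith [(ht01 i).2]
  have hθ1 : ∑ ε, θ ε = 1 := sum_trilinear_eq_one t
  have hθx : ∀ μ, ∑ ε, θ ε * (((p ε) μ : ℤ) : ℝ) = ((x μ : ℤ) : ℝ) := by
    intro μ
    have e : ∀ ε, θ ε * (((p ε) μ : ℤ) : ℝ) = θ ε * ((v μ : ℤ) : ℝ) + (s : ℝ) * (θ ε * (((ε μ : ℕ) : ℝ))) := by
      intro ε; rw [hp]; push_cast; ring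
    simp only [e]
    rw [Finset.sum_add_distrib, ← Finset.sum_mul, ← Finset.mul_sum, hθ1, sum_trilinear_mul_eq t μ, ht]
    simp only
    field_simp
    push_cast
    ring
  -- the affine part at `x` is the weighted sum of its vertex values
  have hA : ∑ μ, m μ * ((x μ : ℤ) : ℝ) = ∑ ε, θ ε * ∑ μ, m μ * (((p ε) μ : ℤ) : ℝ) := by
    calc ∑ μ, m μ * ((x μ : ℤ) : ℝ) = ∑ μ, m μ * ∑ ε, θ ε * (((p ε) μ : ℤ) : ℝ) := Finset.sum_congr rfl fun μ _ => by rw [hθx μ]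
      _ = ∑ μ, ∑ ε, θ ε * (m μ * (((p ε) μ : ℤ) : ℝ)) := Finset.sum_congr rfl fun μ _ => by rw [Finset.mul_sum]; exact Finset.sum_congr rfl fun ε _ => by ring
      _ = ∑ ε, ∑ μ, θ ε * (m μ * (((p ε) μ : ℤ) : ℝ)) := Finset.sum_comm
      _ = ∑ ε, θ ε * ∑ μ, m μ * (((p ε) μ : ℤ) : ℝ) := Finset.sum_congr rfl fun ε _ => by rw [Finset.mul_sum]
  -- vertex values of the affine part: `A(p_ε) = −w(p_ε)` since `u(p_ε) = 0`
  have hAp : ∀ ε, ∑ μ, m μ * (((p ε) μ : ℤ) : ℝ) = -w (p ε) := by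
    intro ε; rw [hw]; simp only; rw [h0 ε]; ring
  -- hence `u x = Σ_ε θ_ε (w x − w p_ε)`
  have hux : u x = ∑ ε, θ ε * (w x - w (p ε)) := by
    have e1 : u x = w x + ∑ μ, m μ * ((x μ : ℤ) : ℝ) := by rw [hw]; simp only; ring
    rw [e1, hA]
    simp only [hAp, mul_sub, Finset.sum_sub_distrib, ← Finset.sum_mul, hθ1, one_mul, mul_neg, Finset.sum_neg_distrib]
    ring
  rw [hux]
  calc |∑ ε, θ ε * (w x - w (p ε))| ≤ ∑ ε, |θ ε * (w x - w (p ε))| := Finset.abs_sum_le_sum_abs _ _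
    _ = ∑ ε, θ ε * |w x - w (p ε)| := Finset.sum_congr rfl fun ε _ => by rw [abs_mul, abs_of_nonneg (hθ0 ε)]
    _ ≤ ∑ ε, θ ε * B := Finset.sum_le_sum fun ε _ => mul_le_mul_of_nonneg_left (hB ε) (hθ0 ε)
    _ = B := by rw [← Finset.sum_mul, hθ1, one_mul]

/-! ## §6 ★★★ The vertex-pinned `H²` Morrey–Poincaré inequality on a cell -/

/-- ★★★ **THE VERTEX-PINNED `H²` MORREY–POINCARÉ INEQUALITY ON A LATTICE CELL OF ℤ³** (brick (D1-cell) of the (α′) sup-row residue (hK)).  Let `s ≥ 1`, `v ∈ ℤ³`, and let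
`u : ℤ³ → ℝ` vanish at the 8 vertices `v + s·ε` (`ε ∈ {0,1}³`) of the cell `Y = Π_i [v_i, v_i + s]`.  Then
`Σ_{x ∈ Y} u(x)² ≤ C_M · s⁴ · Σ_μ gradSq (∂_μ u) (Q_{5s+1}(v))`, `C_M = 24·289·24576·46116` (absolute; `Q_{5s+1}(v)` = the sup-ball of radius `5s+1` about `v`;
the right side is the lattice Hessian energy `Σ_{μ,ν} Σ (∂_ν∂_μ u)²` near the cell).  Proof: §3–§4 (Morrey growth of `u −` mean-gradient affine part ⟹ `C^{1∕2}` oscillation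
`≤ C√(H·s)` over the cell by ✓ `abs_sub_le_of_morrey`), §5 (8 vertex zeros kill the affine part), `#Y·osc² ≤ (s+1)³(2s+1)·C·H ≤ 24s⁴·C·H`.
[cite: Giaquinta1984, Ch. III §1 Thm 1.2 pp.70–72; Balaban1985Variational, Prop. 7 p.299] -/
theorem sum_sq_le_hessian_of_vanish_vertices (hd : d = 3) (u : Zd d → ℝ) (v : Zd d) {s : ℕ} (hs : 1 ≤ s)
    (h0 : ∀ ε : Fin d → Fin 2, u (fun i => v i + (s : ℤ) * ((ε i : ℕ) : ℤ)) = 0) :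
    ∑ x ∈ Fintype.piFinset (fun i => Finset.Icc (v i) (v i + s)), (u x) ^ 2
      ≤ (24 * 289 * 24576 * 46116 : ℝ) * (s : ℝ) ^ 4 * ∑ μ, gradSq (fdiff μ u) (box v (5 * (s : ℤ) + 1)) := by
  classical
  subst hd
  set H : ℝ := ∑ μ, gradSq (fdiff μ u) (box v (5 * (s : ℤ) + 1)) with hH
  have hHμ : ∀ μ, gradSq (fdiff μ u) (box v (5 * (s : ℤ) + 1)) ≤ H := fun μ =>
    Finset.single_le_sum (f := fun μ => gradSq (fdiff μ u) (box v (5 * (s : ℤ) + 1))) (fun _ _ => gradSq_nonneg _ _) (Finset.mem_univ μ)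
  have hH0 : 0 ≤ H := Finset.sum_nonneg fun _ _ => gradSq_nonneg _ _
  set m : Fin 3 → ℝ := fun μ => boxAvg (fdiff μ u) v (5 * (s : ℤ) + 1) with hm
  set B : ℝ := 17 * Real.sqrt (16 * (3 : ℕ) * 8 ^ 3) * Real.sqrt (46116 * H * (2 * (s : ℝ) + 1)) with hB
  set Y := Fintype.piFinset (fun i => Finset.Icc (v i) (v i + s)) with hY
  have hs0 : (0 : ℝ) < s := by exact_mod_cast hs
  -- every point of the cell, and every vertex, is within `s` of `v`; any two cell points are within `s` of each other
  have hmemY : ∀ {x : Zd 3}, x ∈ Y → ∀ i, v i ≤ x i ∧ x i ≤ v i + s := fun hx i => by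
    have := Fintype.mem_piFinset.mp hx i; rwa [Finset.mem_Icc] at this
  have hvert : ∀ ε : Fin 3 → Fin 2, (fun i => v i + (s : ℤ) * ((ε i : ℕ) : ℤ)) ∈ Y := by
    intro ε
    refine Fintype.mem_piFinset.mpr fun i => Finset.mem_Icc.mpr ⟨?_, ?_⟩
    · have : (0 : ℤ) ≤ ((ε i : ℕ) : ℤ) := by positivity
      nlinarith
    · have : ((ε i : ℕ) : ℤ) ≤ 1 := by have := (ε i).is_lt; omega
      nlinarith
  have hnear : ∀ {x : Zd 3}, x ∈ Y → ∀ i, |x i - v i| ≤ (s : ℤ) := fun hx i => by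
    obtain ⟨h1, h2⟩ := hmemY hx i; rw [abs_le]; constructor <;> linarith
  have hbox : ∀ {x a : Zd 3}, x ∈ Y → a ∈ Y → x ∈ box a (s : ℤ) := fun hx ha => by
    rw [mem_box]; intro i
    obtain ⟨h1, h2⟩ := hmemY hx i; obtain ⟨h3, h4⟩ := hmemY ha i
    rw [abs_le]; constructor <;> linarith
  -- pointwise bound on the cell
  have hpt : ∀ x ∈ Y, |u x| ≤ B := by
    intro x hx
    refine abs_le_of_vanish_vertices u m v hs hx h0 fun ε => ?_
    exact abs_sub_affineCorr_le rfl u v hs hHμ (hnear (hvert ε)) (hnear hx) (hbox hx (hvert ε))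
  -- square and sum
  have hB0 : 0 ≤ B := by rw [hB]; positivity
  have hB2 : B ^ 2 = 289 * (16 * 3 * 8 ^ 3) * (46116 * H * (2 * (s : ℝ) + 1)) := by
    rw [hB, mul_pow, mul_pow, Real.sq_sqrt (by positivity), Real.sq_sqrt (by positivity)]; push_cast; ring
  have hcard : (Y.card : ℝ) = ((s : ℝ) + 1) ^ 3 := by
    rw [hY, Fintype.card_piFinset]
    simp only [Int.card_Icc]
    have e : ∀ i : Fin 3, (v i + (s : ℤ) + 1 - v i).toNat = s + 1 := fun i => by
      rw [show v i + (s : ℤ) + 1 - v i = ((s + 1 : ℕ) : ℤ) by push_cast; ring, Int.toNat_natCast]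
    simp only [e, Finset.prod_const, Finset.card_univ, Fintype.card_fin]
    push_cast; ring
  calc ∑ x ∈ Y, (u x) ^ 2 ≤ ∑ x ∈ Y, B ^ 2 := Finset.sum_le_sum fun x hx => by
          have h := hpt x hx
          calc (u x) ^ 2 = |u x| ^ 2 := (sq_abs _).symm
            _ ≤ B ^ 2 := pow_le_pow_left₀ (abs_nonneg _) h 2
    _ = ((s : ℝ) + 1) ^ 3 * B ^ 2 := by rw [Finset.sum_const, nsmul_eq_mul, hcard]
    _ = ((s : ℝ) + 1) ^ 3 * (2 * (s : ℝ) + 1) * (289 * (16 * 3 * 8 ^ 3) * 46116) * H := by rw [hB2]; ring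
    _ ≤ 24 * (s : ℝ) ^ 4 * (289 * (16 * 3 * 8 ^ 3) * 46116) * H := by
        have hs1 : (1 : ℝ) ≤ s := by exact_mod_cast hs
        have hpoly : ((s : ℝ) + 1) ^ 3 * (2 * (s : ℝ) + 1) ≤ 24 * (s : ℝ) ^ 4 := by
          nlinarith [pow_le_pow_left₀ (by linarith : (0:ℝ) ≤ (s:ℝ) + 1) (by linarith : (s : ℝ) + 1 ≤ 2 * s) 3,
            mul_nonneg (pow_nonneg hs0.le 3) hs0.le, pow_nonneg hs0.le 4]
        have hK0 : (0 : ℝ) ≤ (289 * (16 * 3 * 8 ^ 3) * 46116) * H := by positivity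
        nlinarith
    _ = (24 * 289 * 24576 * 46116 : ℝ) * (s : ℝ) ^ 4 * H := by ring

end Summit.QuantumFields.YangMills.Theorems.Prop7VertexPinnedMorreyCell

end
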